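import Summits.MatrixMultiplication.OmegaCensus.STPPTightN18CriticalPair
import Literature.Combinatorics.Additive.CriticalSumProgressionOrQuasiPeriodic

/-!
# ω-census (abelian STPP census): critical pairs in `ℤ/46ℤ` — the AP / `K`-periodic dichotomy (kernel)

HONEST FRAMING (pub-omega census; verbatim): lottery ticket; floor = certified bounds/negative ranges.
Census STRUCTURE (seat pub-omega-stpp-2 gen 32, 2026-08-30), family (b2).  Tools for ANALYSING the last residual pattern of order `46`
(`{(2,2,3),(3,3,2),(3,3,2)}`, N18-tight at both `(3,3,2)` blocks: `STPPTightN18CriticalPair.lean`); nothing here is progress on `ω`.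

## Content

`ℤ/46ℤ` has exactly the subgroups of orders `1, 2, 23, 46`; the one of order `2` is `K = {0, 23}` (§1).  For a CRITICAL PAIR `(A, B)`
(`|A + B| + 1 = |A| + |B|`, `|A|, |B| ≥ 2`) whose sum has EVEN size `< 23`, Kemperman's Theorem 2.1 (tree:
`isAP_or_isQuasiPeriodic_add_of_card_add_le` — the sum is an arithmetic progression or quasi-periodic) leaves exactly two cases (§2,
`isAP_or_vadd23_of_critical`): `A + B` is an ARITHMETIC PROGRESSION, or `A + B` is `K`-PERIODIC (`23 + (A + B) = A + B`) — a quasi-periodic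
set of even size `< 23` can only have quasi-period `K` with a full (or empty) residual coset.  §4 (the periodic case): with `|A| = 3`, `|B| = 12`,
Kneser's theorem forces `B` itself to be `K`-periodic and `A` to contain a `K`-coset (`vadd23_and_coset_of_periodic_sum`); with `A = {c, c + δ}`,
`|B| = 13` it forces `δ = 23` (`eq_23_of_periodic_pair_sum`).  The AP case (AP sum ⇒ AP summands) is the companion file `STPPCriticalPairsZ46APSum.lean`.

These are the order-`46` replacements for Vosper's theorem in the prime-order clash files (`STPPVosperTightStructure.lean`).

References: J. H. B. Kemperman, Acta Math. 103 (1960), Thm 2.1 (tree); M. Kneser, Math. Z. 58 (1953) (tree: `add_kneser`); H. Cohn, R. Kleinberg,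
B. Szegedy, C. Umans, FOCS 2005 (arXiv:math/0511460), Def. 5.1.
-/

open Finset
open scoped Pointwise

namespace Summit.MatrixMultiplication.OmegaCensus.Z46

open Literature.Combinatorics.Additive

/-! ## §1 The subgroups of `ℤ/46ℤ` -/

/-- A subgroup of `ℤ/46ℤ` has order `1, 2, 23` or `46` (Lagrange). [folklore] -/
theorem natCard_addSubgroup_mem (F : AddSubgroup (ZMod 46)) : Nat.card F ∈ ({1, 2, 23, 46} : Finset ℕ) := by
  have h : Nat.card F ∣ 46 := by
    have := AddSubgroup.card_addSubgroup_dvd_card F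
    rwa [Nat.card_zmod] at this
  have hmem : Nat.card F ∈ Nat.divisors 46 := Nat.mem_divisors.2 ⟨h, by norm_num⟩
  exact (by decide : Nat.divisors 46 ⊆ ({1, 2, 23, 46} : Finset ℕ)) hmem

/-- The elements of `ℤ/46ℤ` killed by `2` are `0` and `23`. [folklore] -/
theorem eq_zero_or_eq_23_of_two_nsmul {x : ZMod 46} (h : 2 • x = 0) : x = 0 ∨ x = 23 := by
  revert x h; decide

/-- A subgroup of order `2` consists of `0` and `23`. [folklore] -/
theorem eq_zero_or_eq_23_of_mem {F : AddSubgroup (ZMod 46)} (hF : Nat.card F = 2) {x : ZMod 46} (hx : x ∈ F) :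
    x = 0 ∨ x = 23 := by
  have h : (Nat.card F) • (⟨x, hx⟩ : F) = 0 := card_nsmul_eq_zero'
  rw [hF] at h
  have h2 : 2 • x = 0 := by
    have := congrArg Subtype.val h
    simpa using this
  exact eq_zero_or_eq_23_of_two_nsmul h2

/-- A subgroup of order `2` contains `23`. [folklore] -/
theorem mem23_of_card_eq_two {F : AddSubgroup (ZMod 46)} (hF : Nat.card F = 2) : (23 : ZMod 46) ∈ F := by
  by_contra h23
  have hall : ∀ x ∈ F, x = (0 : ZMod 46) := fun x hx =>
    (eq_zero_or_eq_23_of_mem hF hx).resolve_right (fun h => h23 (h ▸ hx))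
  have hbot : F = ⊥ := (AddSubgroup.eq_bot_iff_forall F).2 hall
  rw [hbot, AddSubgroup.card_bot] at hF
  omega

/-- A `K`-periodic set (`K` the subgroup of order `2`) is invariant under translation by `23`. [folklore] -/
theorem vadd23_eq_of_isPeriodicWith {F : AddSubgroup (ZMod 46)} (hF : Nat.card F = 2) {X : Finset (ZMod 46)}
    (hX : IsPeriodicWith F X) : (23 : ZMod 46) +ᵥ X = X :=
  hX 23 (mem23_of_card_eq_two hF)

/-- A set invariant under `x ↦ x + 23` has even cardinality: it is the disjoint union of its "low" half `{x ∈ X : x < 23}` and the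
translate of that half by `23`. [folklore] -/
theorem even_card_of_vadd23_eq {X : Finset (ZMod 46)} (hX : (23 : ZMod 46) +ᵥ X = X) : Even #X := by
  set Y := X.filter (fun x => x.val < 23) with hY
  have hlow : ∀ x : ZMod 46, ¬ x.val < 23 → (x - 23).val < 23 := by decide
  have hhigh : ∀ x : ZMod 46, x.val < 23 → ¬ (x + 23).val < 23 := by decide
  have hmemX : ∀ x, x ∈ X → x + 23 ∈ X := fun x hx => by
    rw [← hX]; exact Finset.mem_vadd_finset.2 ⟨x, hx, by rw [vadd_eq_add, add_comm]⟩
  have hmemX' : ∀ x, x ∈ X → x - 23 ∈ X := fun x hx => by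
    rw [← hX] at hx
    obtain ⟨y, hy, hyx⟩ := Finset.mem_vadd_finset.1 hx
    rw [vadd_eq_add] at hyx
    have : x - 23 = y := by rw [← hyx]; abel
    rw [this]; exact hy
  have hsplit : X = Y ∪ Y.image (fun x => x + 23) := by
    ext x
    simp only [hY, Finset.mem_union, Finset.mem_filter, Finset.mem_image]
    constructor
    · intro hx
      by_cases h : x.val < 23
      · exact Or.inl ⟨hx, h⟩
      · exact Or.inr ⟨x - 23, ⟨hmemX' x hx, hlow x h⟩, by abel⟩
    · rintro (⟨hx, -⟩ | ⟨y, ⟨hy, -⟩, rfl⟩)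
      · exact hx
      · exact hmemX y hy
  have hdisj : Disjoint Y (Y.image (fun x => x + 23)) := by
    rw [Finset.disjoint_left]
    intro x hx hx'
    simp only [hY, Finset.mem_filter, Finset.mem_image] at hx hx'
    obtain ⟨y, ⟨-, hy⟩, rfl⟩ := hx'
    exact hhigh y hy hx.2
  have hinj : #(Y.image (fun x => x + 23)) = #Y := Finset.card_image_of_injective _ (add_left_injective 23)
  rw [hsplit, Finset.card_union_of_disjoint hdisj, hinj]
  exact ⟨#Y, rfl⟩

/-! ## §2 Kemperman's dichotomy for critical sums of even size `< 23` -/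

/-- A QUASI-PERIODIC subset of `ℤ/46ℤ` of even size `< 23` is `K`-periodic: the quasi-period can only be the subgroup of order `2`, and the
residual coset is then empty or full. [cite: Grynkiewicz2009, §2] -/
theorem vadd23_eq_of_isQuasiPeriodic {P : Finset (ZMod 46)} (hq : IsQuasiPeriodic P) (h23 : #P < 23) (hev : Even #P) :
    (23 : ZMod 46) +ᵥ P = P := by
  obtain ⟨F, P₁, P₀, hd, hne⟩ := hq
  obtain ⟨Ff, hFf, hFfcard⟩ := exists_finset_carrier (H := F) (Set.toFinite _)
  have hP₁card : #P₁ = cosetCount F P₁ * #Ff := card_eq_cosetCount_mul hFf hd.periodic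
  have hpos : 0 < cosetCount F P₁ := cosetCount_pos hne
  have hP₁le : #P₁ ≤ #P := card_le_card hd.left_subset
  have hF2 : Nat.card F = 2 := by
    have hmem := natCard_addSubgroup_mem F
    simp only [Finset.mem_insert, Finset.mem_singleton] at hmem
    rcases hmem with h | h | h | h
    · exact absurd (AddSubgroup.eq_bot_of_card_eq F h) hd.ne_bot
    · exact h
    · exfalso
      rw [hFfcard, h] at hP₁card
      have : 23 ≤ #P₁ := by rw [hP₁card]; exact Nat.le_mul_of_pos_left 23 hpos
      omega
    · exfalso
      rw [hFfcard, h] at hP₁card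
      have : 46 ≤ #P₁ := by rw [hP₁card]; exact Nat.le_mul_of_pos_left 46 hpos
      omega
  have h23F : (23 : ZMod 46) ∈ F := mem23_of_card_eq_two hF2
  have hP₁inv : (23 : ZMod 46) +ᵥ P₁ = P₁ := hd.periodic 23 h23F
  have hFf2 : #Ff = 2 := by rw [hFfcard, hF2]
  have hP₀ev : Even #P₀ := by
    have hsum : #P = #P₁ + #P₀ := hd.card_eq
    rw [hFf2] at hP₁card
    obtain ⟨r, hr⟩ := hev
    exact ⟨r - cosetCount F P₁, by omega⟩
  have hP₀inv : (23 : ZMod 46) +ᵥ P₀ = P₀ := by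
    rcases P₀.eq_empty_or_nonempty with h0 | ⟨x₀, hx₀⟩
    · rw [h0, Finset.vadd_finset_empty]
    · have hne23 : x₀ ≠ x₀ + 23 := by
        intro h
        have h' : (23 : ZMod 46) = 0 := by
          have := congrArg (fun y => y - x₀) h
          simp only [sub_self, add_sub_cancel_left] at this
          exact this.symm
        exact absurd h' (by decide)
      have hsub : P₀ ⊆ {x₀, x₀ + 23} := by
        intro x hx
        have hxF := hd.sub_mem x hx x₀ hx₀
        rcases eq_zero_or_eq_23_of_mem hF2 hxF with h | h
        · rw [sub_eq_zero] at h
          rw [h]; exact Finset.mem_insert_self _ _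
        · have hx' : x = x₀ + 23 := by rw [← h]; abel
          rw [hx']; exact Finset.mem_insert_of_mem (Finset.mem_singleton_self _)
      have hcard2 : #({x₀, x₀ + 23} : Finset (ZMod 46)) = 2 := Finset.card_pair hne23
      have hle : #P₀ ≤ 2 := hcard2 ▸ Finset.card_le_card hsub
      have hge : 1 ≤ #P₀ := Finset.card_pos.2 ⟨x₀, hx₀⟩
      have hP₀2 : #P₀ = 2 := by obtain ⟨r, hr⟩ := hP₀ev; omega
      have heq : P₀ = {x₀, x₀ + 23} := Finset.eq_of_subset_of_card_le hsub (by rw [hcard2, hP₀2])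
      rw [heq, Finset.vadd_finset_insert, Finset.vadd_finset_singleton, vadd_eq_add, vadd_eq_add]
      have e1 : (23 : ZMod 46) + x₀ = x₀ + 23 := add_comm _ _
      have e2 : (23 : ZMod 46) + (x₀ + 23) = x₀ := by
        rw [add_comm, add_assoc, (by decide : (23 : ZMod 46) + 23 = 0), add_zero]
      rw [e1, e2, Finset.pair_comm]
  rw [← hd.union_eq, Finset.vadd_finset_union, hP₁inv, hP₀inv]

/-- **Kemperman's dichotomy in `ℤ/46ℤ`.**  For a critical pair `(A, B)` (`|A|, |B| ≥ 2`, `|A + B| + 1 ≤ |A| + |B|`) whose sum has even size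
`< 23`: either `A + B` is an arithmetic progression, or `A + B` is `K`-periodic (`23 + (A + B) = A + B`).
[cite: Kemperman1960, Thm 2.1] [cite: Grynkiewicz2009, §2] -/
theorem isAP_or_vadd23_of_critical {A B : Finset (ZMod 46)} (hA : 2 ≤ #A) (hB : 2 ≤ #B)
    (hcrit : #(A + B) + 1 ≤ #A + #B) (h23 : #(A + B) < 23) (hev : Even #(A + B)) :
    (∃ d, IsAP (A + B) d) ∨ (23 : ZMod 46) +ᵥ (A + B) = A + B := by
  rcases isAP_or_isQuasiPeriodic_add_of_card_add_le hA hB hcrit with h | h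
  · exact Or.inl h
  · exact Or.inr (vadd23_eq_of_isQuasiPeriodic h h23 hev)

/-! ## §4 The `K`-periodic case (§3, the AP case, is `STPPCriticalPairsZ46APSum.lean`) -/

section Periodic

/-- The stabilizer of a `K`-periodic `14`-set of `ℤ/46ℤ` is exactly `{0, 23}`. [cite: Kneser1953] -/
theorem addStab_eq_of_vadd23 {P : Finset (ZMod 46)} (hP : #P = 14) (h23 : (23 : ZMod 46) +ᵥ P = P) :
    P.addStab = {0, 23} := by
  have hne : P.Nonempty := Finset.card_pos.1 (by omega)
  have hdvd14 : #P.addStab ∣ 14 := hP ▸ Finset.card_addStab_dvd_card P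
  have hdvd46 : #P.addStab ∣ 46 := by
    have := hne.card_addStab_dvd_card_univ
    rwa [ZMod.card] at this
  have hsub : ({0, 23} : Finset (ZMod 46)) ⊆ P.addStab := by
    intro x hx
    simp only [Finset.mem_insert, Finset.mem_singleton] at hx
    rcases hx with rfl | rfl
    · exact hne.zero_mem_addStab
    · exact (Finset.mem_addStab hne).2 h23
  have h2 : #({0, 23} : Finset (ZMod 46)) = 2 := by decide
  have hle : #P.addStab ≤ 2 := by
    have h1 : #P.addStab ∣ Nat.gcd 14 46 := Nat.dvd_gcd hdvd14 hdvd46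
    have : Nat.gcd 14 46 = 2 := by decide
    rw [this] at h1
    exact Nat.le_of_dvd (by norm_num) h1
  exact (Finset.eq_of_subset_of_card_le hsub (by rw [h2]; exact hle)).symm

/-- **Periodic `(2,13)` pairs:** if `C = {c, c + δ}` (`δ ≠ 0`), `|S| = 13`, `|C + S| = 14` and `C + S` is `K`-periodic, then `δ = 23`
(`C` is a `K`-coset). [cite: Kneser1953] -/
theorem eq_23_of_periodic_pair_sum {c δ : ZMod 46} {S : Finset (ZMod 46)} (hδ : δ ≠ 0) (hS : #S = 13)
    (h14 : #(({c, c + δ} : Finset (ZMod 46)) + S) = 14) (h23 : (23 : ZMod 46) +ᵥ (({c, c + δ} : Finset (ZMod 46)) + S) = {c, c + δ} + S) :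
    δ = 23 := by
  set P := ({c, c + δ} : Finset (ZMod 46)) + S with hPdef
  have hPne : P.Nonempty := Finset.card_pos.1 (by omega)
  -- `S ∪ (23 + S)` has at least 14 elements (`13` is odd)
  have hS23 : (23 : ZMod 46) +ᵥ S ≠ S := by
    intro h
    have := even_card_of_vadd23_eq h
    rw [hS] at this
    exact absurd this (by decide)
  have hbig : 14 ≤ #(S ∪ ((23 : ZMod 46) +ᵥ S)) := by
    have hlt : S ⊂ S ∪ ((23 : ZMod 46) +ᵥ S) := by
      refine Finset.ssubset_iff_subset_ne.2 ⟨Finset.subset_union_left, fun h => hS23 ?_⟩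
      have hsub : (23 : ZMod 46) +ᵥ S ⊆ S := fun x hx => by rw [h]; exact Finset.mem_union_right _ hx
      exact Finset.eq_of_subset_of_card_le hsub (by rw [Finset.card_vadd_finset])
    have := Finset.card_lt_card hlt
    omega
  -- `c + (S ∪ (23 + S)) = P`
  have hcS : c +ᵥ (S ∪ ((23 : ZMod 46) +ᵥ S)) ⊆ P := by
    intro x hx
    rw [Finset.mem_vadd_finset] at hx
    obtain ⟨y, hy, rfl⟩ := hx
    rcases Finset.mem_union.1 hy with hyS | hy23
    · exact Finset.mem_add.2 ⟨c, by simp, y, hyS, rfl⟩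
    · obtain ⟨s, hs, rfl⟩ := Finset.mem_vadd_finset.1 hy23
      have hcs : c + s ∈ P := Finset.mem_add.2 ⟨c, by simp, s, hs, rfl⟩
      have : (23 : ZMod 46) +ᵥ (c + s) ∈ (23 : ZMod 46) +ᵥ P := Finset.vadd_mem_vadd_finset hcs
      rw [h23] at this
      have e : c +ᵥ ((23 : ZMod 46) +ᵥ s) = (23 : ZMod 46) +ᵥ (c + s) := by
        simp only [vadd_eq_add]; abel
      rw [e]; exact this
  have hcSeq : c +ᵥ (S ∪ ((23 : ZMod 46) +ᵥ S)) = P :=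
    Finset.eq_of_subset_of_card_le hcS (by rw [Finset.card_vadd_finset]; omega)
  -- hence `δ + P ⊆ P`
  have hδP : δ +ᵥ P = P := by
    apply Finset.eq_of_subset_of_card_le _ (by rw [Finset.card_vadd_finset])
    intro x hx
    obtain ⟨y, hy, rfl⟩ := Finset.mem_vadd_finset.1 hx
    rw [← hcSeq] at hy
    obtain ⟨z, hz, rfl⟩ := Finset.mem_vadd_finset.1 hy
    rcases Finset.mem_union.1 hz with hzS | hz23
    · -- δ + (c + z) = (c + δ) + z ∈ P
      have : (c + δ) + z ∈ P := Finset.mem_add.2 ⟨c + δ, by simp, z, hzS, rfl⟩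
      have e : δ +ᵥ (c +ᵥ z) = (c + δ) + z := by simp only [vadd_eq_add]; abel
      rw [e]; exact this
    · obtain ⟨s, hs, rfl⟩ := Finset.mem_vadd_finset.1 hz23
      have h1 : (c + δ) + s ∈ P := Finset.mem_add.2 ⟨c + δ, by simp, s, hs, rfl⟩
      have h2 : (23 : ZMod 46) +ᵥ ((c + δ) + s) ∈ (23 : ZMod 46) +ᵥ P := Finset.vadd_mem_vadd_finset h1
      rw [h23] at h2
      have e : δ +ᵥ (c +ᵥ ((23 : ZMod 46) +ᵥ s)) = (23 : ZMod 46) +ᵥ ((c + δ) + s) := by simp only [vadd_eq_add]; abel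
      rw [e]; exact h2
  -- the stabilizer is `{0, 23}` and contains `δ`
  have hstab := addStab_eq_of_vadd23 h14 h23
  have hδmem : δ ∈ P.addStab := (Finset.mem_addStab hPne).2 hδP
  rw [hstab] at hδmem
  simp only [Finset.mem_insert, Finset.mem_singleton] at hδmem
  exact hδmem.resolve_left hδ

/-- **Periodic `(3,12)` pairs:** if `|A| = 3`, `|T| = 12`, `|A + T| = 14` and `A + T` is `K`-periodic, then `T` is `K`-periodic and `A`
contains a `K`-coset `{a, a + 23}` (Kneser: `|A + K| + |T + K| ≤ 14 + 2`). [cite: Kneser1953] -/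
theorem vadd23_and_coset_of_periodic_sum {A T : Finset (ZMod 46)} (hA : #A = 3) (hT : #T = 12) (h14 : #(A + T) = 14)
    (h23 : (23 : ZMod 46) +ᵥ (A + T) = A + T) :
    (23 : ZMod 46) +ᵥ T = T ∧ ∃ a ∈ A, a + 23 ∈ A := by
  have hstab := addStab_eq_of_vadd23 h14 h23
  have hkn := add_kneser A T
  rw [hstab] at hkn
  have h2 : #({0, 23} : Finset (ZMod 46)) = 2 := by decide
  rw [h14, h2] at hkn
  -- the two hulls
  have hK : ∀ X : Finset (ZMod 46), X + ({0, 23} : Finset (ZMod 46)) = X ∪ ((23 : ZMod 46) +ᵥ X) := by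
    intro X
    ext x
    simp only [Finset.mem_add, Finset.mem_insert, Finset.mem_singleton, Finset.mem_union, Finset.mem_vadd_finset, vadd_eq_add]
    constructor
    · rintro ⟨y, hy, z, (rfl | rfl), rfl⟩
      · exact Or.inl (by rw [add_zero]; exact hy)
      · exact Or.inr ⟨y, hy, add_comm _ _⟩
    · rintro (hx | ⟨y, hy, rfl⟩)
      · exact ⟨x, hx, 0, Or.inl rfl, add_zero x⟩
      · exact ⟨y, hy, 23, Or.inr rfl, add_comm _ _⟩
  rw [hK A, hK T] at hkn
  have hTge : 12 ≤ #(T ∪ ((23 : ZMod 46) +ᵥ T)) := hT ▸ Finset.card_le_card Finset.subset_union_left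
  -- `A ∪ (23 + A)` is `K`-periodic hence even, and has at least `3` elements, so at least `4`
  have hAinv : (23 : ZMod 46) +ᵥ (A ∪ ((23 : ZMod 46) +ᵥ A)) = A ∪ ((23 : ZMod 46) +ᵥ A) := by
    rw [Finset.vadd_finset_union, vadd_vadd, (by decide : (23 : ZMod 46) + 23 = 0), zero_vadd, Finset.union_comm]
  have hAev : Even #(A ∪ ((23 : ZMod 46) +ᵥ A)) := even_card_of_vadd23_eq hAinv
  have hAge3 : 3 ≤ #(A ∪ ((23 : ZMod 46) +ᵥ A)) := hA ▸ Finset.card_le_card Finset.subset_union_left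
  have hAge : 4 ≤ #(A ∪ ((23 : ZMod 46) +ᵥ A)) := by obtain ⟨r, hr⟩ := hAev; omega
  have hTeq : #(T ∪ ((23 : ZMod 46) +ᵥ T)) = 12 := by omega
  have hAeq : #(A ∪ ((23 : ZMod 46) +ᵥ A)) = 4 := by omega
  constructor
  · -- `23 + T ⊆ T`
    have hU : T ∪ ((23 : ZMod 46) +ᵥ T) = T :=
      (Finset.eq_of_subset_of_card_le Finset.subset_union_left (by rw [hTeq, hT])).symm
    have hsub : (23 : ZMod 46) +ᵥ T ⊆ T := by
      intro x hx; rw [← hU]; exact Finset.mem_union_right _ hx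
    exact Finset.eq_of_subset_of_card_le hsub (by rw [Finset.card_vadd_finset])
  · -- `|A ∩ (23 + A)| = 2 ≥ 1`
    have hinter : (A ∩ ((23 : ZMod 46) +ᵥ A)).Nonempty := by
      rw [← Finset.card_pos]
      have := Finset.card_union_add_card_inter A ((23 : ZMod 46) +ᵥ A)
      rw [hAeq, Finset.card_vadd_finset, hA] at this
      omega
    obtain ⟨x, hx⟩ := hinter
    rw [Finset.mem_inter, Finset.mem_vadd_finset] at hx
    obtain ⟨hxA, y, hy, rfl⟩ := hx
    exact ⟨y, hy, by rw [add_comm]; exact hxA⟩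

end Periodic

end Summit.MatrixMultiplication.OmegaCensus.Z46
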